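import Literature.Barriers.MatrixMultiplication.RectangularBarrier
import Literature.Computability.AlgebraicComplexity.AsymptoticSpectrumDuality
import Literature.Computability.AlgebraicComplexity.UnitTensorMomentPolytopeProofs
import Mathlib.Analysis.SpecialFunctions.Log.Base
import HarnessLib

/-!
# The worst-case tensor exponent `σ(d)` of `d × d × d` tensors (Kaski–Michałek 2025)

Topic `Literature/Computability/AlgebraicComplexity` (family `MatrixMultiplication`). Source: P. Kaski,
M. Michałek, *A universal sequence of tensors for the asymptotic rank conjecture*, ITCS 2025 =
arXiv:2404.06427, §1.1 (held text `paper:arxiv-2404.06427`, p0001 L43 – p0002 L2, p0002 L40–41 and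
footnote 1): "the exponent of a nonzero tensor `T ∈ 𝔽^d ⊗ 𝔽^d ⊗ 𝔽^d` is the least nonnegative real
`σ(T)` such that the sequence of tensor (Kronecker) powers … has its sequence of tensor ranks
bounded by `R(T^{⊠p}) ≤ d^{σ(T)p + o(p)}`" — footnote 1: "The asymptotic rank of `T` is
`R̃(T) = lim_p R(T^{⊠p})^{1/p}` and we have `R̃(T) = d^{σ(T)}`" — and "For a space `F` of tensors, let
`σ(F) = sup_{T ∈ F} σ(T)`; as a special case, for `d = 1, 2, …` let `σ(d) = σ(𝔽^d ⊗ 𝔽^d ⊗ 𝔽^d)`. It is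
immediate that `1 ≤ σ(d) ≤ 2` …".  Alman–Li 2026 (arXiv:2605.21738, §7.2, p0019 L60): "Let `σ(d)`
denote the exponent of `d × d × d` tensors [KM25], i.e., the smallest `σ` such that every `d × d × d`
tensor `T` satisfies `R̃(T) ≤ d^σ`."

## What is defined and proved

* `worstCaseTensorExponent K d` — `σ(d) := sup_T log_d R̃(T)` over ALL `T : Fin d → Fin d → Fin d → K`
  (by footnote 1, `σ(T) = log_d R̃(T)` for `T ≠ 0`; the zero tensor contributes `Real.logb d 0 = 0`,
  which lies below `σ(⟨d⟩) = 1`, so for `d ≥ 2` this is the printed `σ(d)`).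
* `logb_asymptoticRank_le_worstCaseTensorExponent` (`σ(T) ≤ σ(d)`),
  `asymptoticRank_le_rpow_worstCaseTensorExponent` ("every `d × d × d` tensor satisfies
  `R̃(T) ≤ d^{σ(d)}`"), `worstCaseTensorExponent_le` ("the smallest such `σ`"), for `d ≥ 2`.
* KM's "`1 ≤ σ(d) ≤ 2`": `worstCaseTensorExponent_le_two` (`R̃(T) ≤ R(T) ≤ d²`, slice rank) and
  `one_le_worstCaseTensorExponent` via `asymptoticRank_unitTensor_eq` (`R̃(⟨d⟩) = d`, Strassen
  duality: tree `strassen_duality_asymptoticRank_holds`).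

Strassen's bound `σ(d) ≤ 2ω/3` and its strict improvement `σ(d) < 2ω/3` for `d ≥ 3` (Alman–Li 2026,
Cor. 7.3) are proved in `AlmanLi2026WorstCaseExponentBound.lean`.  No named facts.

## References

* P. Kaski, M. Michałek, *A universal sequence of tensors for the asymptotic rank conjecture*, ITCS 2025,
  LIPIcs 325, 64:1–64:24; arXiv:2404.06427, §1.1. [KaskiMichalek2025]
* M. Christandl, P. Vrana, J. Zuiddam, *Universal points in the asymptotic spectrum of tensors*,
  J. AMS 36 (2023), Prop. 1.6, §1.2. [ChristandlVranaZuiddam2023]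
* M. Bläser, *Fast Matrix Multiplication*, Theory of Computing Graduate Surveys 5 (2013), §4.
  [Blaser2013]
* J. Alman, B. Li, *Asymptotic Rank Speedup Theorems, Revisited*, arXiv:2605.21738 (2026), §7.2.
  [AlmanLi2026]
-/

noncomputable section

open scoped BigOperators

namespace Literature.Computability.AlgebraicComplexity

variable (K : Type) [Field K]

/-- **The worst-case tensor exponent `σ(d)`** of Kaski–Michałek: `σ(d) = sup_T σ(T)` over
`T ∈ K^d ⊗ K^d ⊗ K^d`, where `σ(T) = log_d R̃(T)` ("`R̃(T) = d^{σ(T)}`"); equivalently (Alman–Li) the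
smallest `σ` with `R̃(T) ≤ d^σ` for every `d × d × d` tensor `T`.  The supremum is taken over all `T`
(the zero tensor contributes `log_d 0 = 0`); meaningful for `d ≥ 2`.
[cite: KaskiMichalek2025, §1.1 (with footnote 1)] [cite: AlmanLi2026, §7.2 (before Cor. 7.3)] -/
def worstCaseTensorExponent (d : ℕ) : ℝ :=
  sSup (Set.range fun T : Fin d → Fin d → Fin d → K => Real.logb d (asymptoticRank T))

/-- Unfolding `σ(d) = sup_T log_d R̃(T)`. [cite: KaskiMichalek2025, §1.1 (with footnote 1)] -/
theorem worstCaseTensorExponent_def (d : ℕ) :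
    worstCaseTensorExponent K d =
      sSup (Set.range fun T : Fin d → Fin d → Fin d → K => Real.logb d (asymptoticRank T)) := rfl

/-- `R̃(T) ≤ d²` for a `d × d × d` tensor (`R̃(T) ≤ R(T^{⊠1}) ≤ |rows|·|columns| = d·d`, slicing
along the third factor). [cite: Blaser2013, §4] -/
theorem asymptoticRank_le_sq {d : ℕ} (T : Fin d → Fin d → Fin d → K) :
    asymptoticRank T ≤ (d : ℝ) ^ 2 := by
  classical
  refine (asymptoticRank_le_tensorRank_pow_one T).trans ?_
  have h := tensorRank_le_card_mul_card₁₂ (K := K) (kroneckerPow T 1)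
  rw [Fintype.card_fun, Fintype.card_fin, Fintype.card_fin, pow_one] at h
  exact_mod_cast (show tensorRank (kroneckerPow T 1) ≤ d ^ 2 by rw [sq]; exact h)

/-- `σ(T) = log_d R̃(T) ≤ 2` for every `d × d × d` tensor (`d ≥ 2`).
[cite: KaskiMichalek2025, §1.1 (p0002 L40–41: "1 ≤ σ(d) ≤ 2")] -/
theorem logb_asymptoticRank_le_two {d : ℕ} (hd : 2 ≤ d) (T : Fin d → Fin d → Fin d → K) :
    Real.logb d (asymptoticRank T) ≤ 2 := by
  have hd1 : (1 : ℝ) < d := by exact_mod_cast hd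
  rcases (asymptoticRank_nonneg T).eq_or_lt with h0 | hpos
  · rw [← h0, Real.logb_zero]
    norm_num
  · calc Real.logb d (asymptoticRank T) ≤ Real.logb d ((d : ℝ) ^ (2 : ℝ)) :=
          Real.logb_le_logb_of_le hd1 hpos (by rw [Real.rpow_two]; exact asymptoticRank_le_sq K T)
      _ = 2 := Real.logb_rpow (by linarith) hd1.ne'

/-- The values `σ(T)` are bounded above (by `2`). [cite: KaskiMichalek2025, §1.1 (p0002 L40–41)] -/
theorem bddAbove_range_logb_asymptoticRank {d : ℕ} (hd : 2 ≤ d) :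
    BddAbove (Set.range fun T : Fin d → Fin d → Fin d → K => Real.logb d (asymptoticRank T)) :=
  ⟨2, by
    rintro _ ⟨T, rfl⟩
    exact logb_asymptoticRank_le_two K hd T⟩

/-- `σ(T) ≤ σ(d)`. [cite: KaskiMichalek2025, §1.1] -/
theorem logb_asymptoticRank_le_worstCaseTensorExponent {d : ℕ} (hd : 2 ≤ d)
    (T : Fin d → Fin d → Fin d → K) :
    Real.logb d (asymptoticRank T) ≤ worstCaseTensorExponent K d :=
  le_csSup (bddAbove_range_logb_asymptoticRank K hd) ⟨T, rfl⟩

/-- **Every `d × d × d` tensor satisfies `R̃(T) ≤ d^{σ(d)}`** (`d ≥ 2`).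
[cite: AlmanLi2026, §7.2 (before Cor. 7.3)] -/
theorem asymptoticRank_le_rpow_worstCaseTensorExponent {d : ℕ} (hd : 2 ≤ d)
    (T : Fin d → Fin d → Fin d → K) :
    asymptoticRank T ≤ (d : ℝ) ^ worstCaseTensorExponent K d := by
  have hd1 : (1 : ℝ) < d := by exact_mod_cast hd
  rcases (asymptoticRank_nonneg T).eq_or_lt with h0 | hpos
  · rw [← h0]
    exact Real.rpow_nonneg (by linarith) _
  · exact (Real.logb_le_iff_le_rpow hd1 hpos).1
      (logb_asymptoticRank_le_worstCaseTensorExponent K hd T)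

/-- **`σ(d)` is the smallest such exponent**: if every `d × d × d` tensor has `R̃(T) ≤ d^s` for some
`s ≥ 0`, then `σ(d) ≤ s` (`d ≥ 2`). [cite: AlmanLi2026, §7.2 (before Cor. 7.3)] -/
theorem worstCaseTensorExponent_le {d : ℕ} (hd : 2 ≤ d) {s : ℝ} (hs : 0 ≤ s)
    (h : ∀ T : Fin d → Fin d → Fin d → K, asymptoticRank T ≤ (d : ℝ) ^ s) :
    worstCaseTensorExponent K d ≤ s := by
  have hd1 : (1 : ℝ) < d := by exact_mod_cast hd
  refine csSup_le ⟨_, ⟨fun _ _ _ => 0, rfl⟩⟩ ?_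
  rintro _ ⟨T, rfl⟩
  show Real.logb d (asymptoticRank T) ≤ s
  rcases (asymptoticRank_nonneg T).eq_or_lt with h0 | hpos
  · rw [← h0, Real.logb_zero]
    exact hs
  · exact (Real.logb_le_iff_le_rpow hd1 hpos).2 (h T)

/-- `σ(d) ≤ 2` (`d ≥ 2`): "It is immediate that `1 ≤ σ(d) ≤ 2`".
[cite: KaskiMichalek2025, §1.1 (p0002 L40–41)] -/
theorem worstCaseTensorExponent_le_two {d : ℕ} (hd : 2 ≤ d) : worstCaseTensorExponent K d ≤ 2 :=
  worstCaseTensorExponent_le K hd (by norm_num) fun T => by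
    rw [Real.rpow_two]; exact asymptoticRank_le_sq K T

/-- `R̃(⟨d⟩) = d`: by Strassen duality some universal spectral point attains `R̃(⟨d⟩)`, and every
universal spectral point maps `⟨d⟩` to `d` (CVZ 2023, Prop. 1.6 with §1.2 (d)).
[cite: ChristandlVranaZuiddam2023, Prop. 1.6] -/
theorem asymptoticRank_unitTensor_eq (d : ℕ) : asymptoticRank (unitTensor K d) = d := by
  obtain ⟨F, hF, hFt⟩ := ((strassen_duality_asymptoticRank_holds K) (unitTensor K d)).2
  rw [← hFt, hF.map_unitTensor]

/-- `1 ≤ σ(d)` (`d ≥ 2`): the unit tensor `⟨d⟩ ∈ K^d ⊗ K^d ⊗ K^d` has `σ(⟨d⟩) = log_d d = 1`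
("It is immediate that `1 ≤ σ(d) ≤ 2`"). [cite: KaskiMichalek2025, §1.1 (p0002 L40–41)] -/
theorem one_le_worstCaseTensorExponent {d : ℕ} (hd : 2 ≤ d) : 1 ≤ worstCaseTensorExponent K d := by
  have hd1 : (1 : ℝ) < d := by exact_mod_cast hd
  have h := logb_asymptoticRank_le_worstCaseTensorExponent K hd (unitTensor K d)
  rwa [asymptoticRank_unitTensor_eq, Real.logb_self_eq_one hd1] at h

end Literature.Computability.AlgebraicComplexity

end
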